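import Summits.BirchSwinnertonDyer.BirchSwinnertonDyer.Theses.ErratumRoadFive
import Summits.BirchSwinnertonDyer.BirchSwinnertonDyer.Theorems.ErratumRoadFiveIMCDivRoadFFFittingFrameBOfThm23SelfDualIrrK
import Summits.BirchSwinnertonDyer.BirchSwinnertonDyer.Theorems.ErratumRoadFiveIMCDivRoadFFFittingFrameBOfThm23SelfDual
import Summits.BirchSwinnertonDyer.BirchSwinnertonDyer.Theorems.ErratumRoadFiveKernelFromPrintBOfFacts
import HarnessLib

/-!
# K2 (route `ErratumRoadFive`, rung K2a, `p ≥ 5`) — the deciding theorem's conclusion with crux 23253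
# `ErratumThm23SigmaLeSelfDual` (F4♯†) REPLACED BY the print-faithful named fact F4♯‡
# (`Castella2018.erratumThm23_charIdeal_sigma_le_of_isTorsion_selfDual_irrK_OPEN`): the RAMFREE re-key rehearsed in the kernel
# (certificate ∕ glue turnkey; helper, `--supports stmt-BirchSwinnertonDyer-23253 --as helper`)

Cell `bsd-stepL` (run/shared/lean/pub/bsd-stepL/), seat `bsd-stepL-imc-p1` (prover g30, 2026-08-29). Theorems only (no definition,
no named fact, no `sorry`, no instance, no notation). This module imports the route file (conclusions are route decls ∕ the rung leaf
by name), so no `_holds` link can be stated here. Memo `HOME/imc-p1/g30/REKEY-K3-imc-p1-g30.md`; design memo of the re-key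
`HOME/imc-p1/g26/RAMFREE-REKEY-PROPOSAL.md` (planner RULING 86 (c): «recorded, not applied» — this file APPLIES NOTHING to the registry;
it certifies what the one-token edit would elaborate to).

## What this file proves

* `imcDivAtErratumDataAllR_of_thm23SelfDualIrrK_OPEN_of_items` — crux 20169 `IMCDivAtErratumDataAllR` BY NAME from F4♯‡ + the THREE route
  items the present `closes` feeds into its `have h3` (23050 `ErratumHidaMemberFramesNonsplitWt` = F3♯†, 20495 `JSWSigmaLocalCharIdeal`,
  19283 `PublishedInputsIMCReduction`): the `have h3` of `Theses.ErratumRoadFive.closes` (rev 71) with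
  `P2.RoadFF.fittingCongruenceFrameAtErratumDataB_of_thm23SelfDualIrrK_OPEN_of_framesNonsplitWt` (imc-p1 g30) in place of
  `…_of_thm23SelfDual_OPEN_of_framesNonsplitWt` (imc-p1 g24).
* `imcDivAtErratumDataAllR_of_thm23SelfDual_of_items` — the same from the CURRENT crux 23253 (`ErratumThm23SigmaLeSelfDual` = F4♯†) by name,
  recorded for symmetry (the `have h3` of `closes` as a citable theorem).
* `multiplicativeRankOne_of_thm23SelfDualIrrK_OPEN_of_items` — **the rung-K2a leaf `X11b.MultiplicativeRankOne` from F4♯‡ and the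
  fourteen OTHER binders of `closes` VERBATIM** (body = `closes`' body, `h3` from the first theorem). Certificate that re-keying crux
  23253 to its print-faithful twin `…_selfDual_irrK_OPEN` (hypotheses (i) «`ρ̄_g|_{G_K}` irreducible» and (iii) «some `q ∥ M` non-split
  in `K`» exactly as in the erratum's Thm. 2.3 and [FW21, Thm. 4.41], NO residual ramification at `q`) changes nothing else in K2's
  dependency cone: every binder type except `h23` is a route decl of `ErratumRoadFive` rev 71, byte-identical with `closes`.

Why the swap elaborates: the erratum datum carries `Irr W p` and a (ram) witness, so `ρ̄_{E,p}` is onto (`surj_of_irr_of_ram`) and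
bsd-stepL-imc-p1 g27's bridge gives (i) for every Hida member `g_m` (`ρ̄_{g_m} ≃ E[p]`, footnote 1); (iii) is the datum's `q ∣ d_K`.

HONEST FRAMING: CONDITIONAL theorems (F4♯‡ is an OPEN claim-tagged `Prop` resting on Castella's unrefereed erratum and arXiv:2107.13726
Thm. 4.41; the fourteen other binders are route items, several open); nothing is booked; no item closes; the anticyclotomic main
conjecture is asserted nowhere; BSD is proved for no pair; no census number moves (T7). F4♯‡ has weaker hypotheses than F4♯†, so
it is the (slightly) stronger open claim — the printed one; the lever it buys (RAMFREE road, NEW_A 7 548 pairs of 19703) is the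
planner's to apply.

References: [Castella2018Erratum] Thm. 1.1, Thm. 2.3 (i)–(iv) with footnote 1, (2.4)–(2.5) (pp. 1–4); [FouquetWan2021] Thm. 4.41
(PREPRINT); [Serre1972] Prop. 15; [JetchevSkinnerWan2017] §5.1, Thm. 3.3.1; [Castella2018Exceptional] Thms. 2.10–2.11;
[Wuthrich2014] Prop. 21.

REPAIR (imc-p1 g35, 2026-08-29; referee g75 GAP of VERDICT-RULING107-FOURWAY-g75.md; ops-buildfix drift read d0840): ER5 rev 73
(RULING 107 B1) REMOVED the route def `ErratumHidaMemberFramesNonsplitWt` (:= F3♯†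
`Castella2018.erratum_exists_frames_members_sigma_congruence_nonsplit_wt`, item 23254 → 24210), which the four theorems below bind by
short name, and rev 75 pruned the route file's imports of `…KernelFromPrintBOfFacts` ∕ `…IMCDivRoadFFFittingFrameBOfThm23SelfDual`, on
which this module free-rode. Repair WITHOUT touching a declaration (the gate's append-only rule refused re-typing the binders, p710217):
the two providers are imported directly, and the short name `ErratumHidaMemberFramesNonsplitWt` is re-bound by an `open … renaming`
to the Literature decl it unfolded to. Every declaration is byte-identical with p688533 and elaborates to the same statement (the old
binder type delta-reduced to exactly this constant). What the file certifies is unchanged: a spent rehearsal of the re-key that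
RULING 107 has since applied for real with F3♯‡ ∕ item 24210 (see `ErratumRoadFiveClosesRamFree`).
-/

set_option autoImplicit false
-- D-0017: single-problem summit, the namespace repeats the problem name by design.
set_option linter.dupNamespace false

noncomputable section

open scoped Classical
open Literature.NumberTheory.EllipticCurves Literature.NumberTheory.EllipticCurves.Castella2018
open Summit.BirchSwinnertonDyer.BirchSwinnertonDyer.Theses.ErratumRoadFive
-- REPAIR (imc-p1 g35): the binder type `ErratumHidaMemberFramesNonsplitWt` of the four theorems below was the route def of
-- item 23254 (:= F3♯†), removed from `Theses.ErratumRoadFive` by rev 73 (RULING 107 B1); the short name is re-bound here to the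
-- Literature decl it unfolded to, so every declaration stays byte-identical (gate append-only rule) and elaborates as before.
open Literature.NumberTheory.EllipticCurves.Castella2018
  renaming erratum_exists_frames_members_sigma_congruence_nonsplit_wt → ErratumHidaMemberFramesNonsplitWt

namespace Summit.BirchSwinnertonDyer.BirchSwinnertonDyer.Theorems.RekeyIrrK

/-- **Crux 20169 `IMCDivAtErratumDataAllR` BY NAME from F4♯‡ (OPEN, print-faithful (i)/(iii)) + three route ITEMS** (23050
`ErratumHidaMemberFramesNonsplitWt`, 20495 `JSWSigmaLocalCharIdeal`, 19283 `PublishedInputsIMCReduction` — its conjuncts 2, 4, 13, 14 =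
GZK, modularity, Poitou–Tate Selmer-structure duality, Ш-duality): Σ-data by
`P2.RoadFF.sigmaDataAtErratumDataB_of_sigmaLocal_of_prop323_of_facts` (theorems + items), Fitting frame by the ‡ consumer
`P2.RoadFF.fittingCongruenceFrameAtErratumDataB_of_thm23SelfDualIrrK_OPEN_of_framesNonsplitWt`, cut
`P2.imcDivIntCoreFrameAtErratumDataB_of_roadFF_fitting` — literally the `have h3` of `closes` with the consumer swapped.
CONDITIONAL on the named inputs (F4♯‡ OPEN, unrefereed); nothing booked.
[cite: Castella2018Erratum, Thm. 2.3 (i), (iii), (2.4)–(2.5) and proof of Thm. 1.1 (pp. 3–4)] [cite: JetchevSkinnerWan2017, §5.1] -/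
theorem imcDivAtErratumDataAllR_of_thm23SelfDualIrrK_OPEN_of_items
    (h23 : erratumThm23_charIdeal_sigma_le_of_isTorsion_selfDual_irrK_OPEN)
    (hMF : ErratumHidaMemberFramesNonsplitWt) (hloc : JSWSigmaLocalCharIdeal) (hF : PublishedInputsIMCReduction) :
    IMCDivAtErratumDataAllR := fun W _ _ p _ ↦
  Summit.BirchSwinnertonDyer.Rank1Residual.X11b.P2.imcDivIntCoreFrameAtErratumDataB_of_roadFF_fitting
    (Summit.BirchSwinnertonDyer.Rank1Residual.X11b.P2.RoadFF.sigmaDataAtErratumDataB_of_sigmaLocal_of_prop323_of_facts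
      W p hloc Literature.NumberTheory.EllipticCurves.SkinnerUrban2014.prop323_XAc_equiv_XBigDecomp_holds
      hF.2.1 hF.2.2.2.1 hF.2.2.2.2.2.2.2.2.2.2.2.2.1 hF.2.2.2.2.2.2.2.2.2.2.2.2.2.1)
    (Summit.BirchSwinnertonDyer.Rank1Residual.X11b.P2.RoadFF.fittingCongruenceFrameAtErratumDataB_of_thm23SelfDualIrrK_OPEN_of_framesNonsplitWt
      h23 hMF W p)

/-- **Crux 20169 `IMCDivAtErratumDataAllR` BY NAME from the CURRENT crux 23253 `ErratumThm23SigmaLeSelfDual` (F4♯†) + the same three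
route ITEMS** — the `have h3` of `Theses.ErratumRoadFive.closes` (rev 71) as a citable theorem (imc-p1 g24's consumer
`…_of_thm23SelfDual_OPEN_of_framesNonsplitWt`). CONDITIONAL (F4♯† OPEN); nothing booked.
[cite: Castella2018Erratum, Thm. 2.3 with footnote 1, (2.4)–(2.5) and proof of Thm. 1.1 (pp. 3–4)] [cite: JetchevSkinnerWan2017, §5.1] -/
theorem imcDivAtErratumDataAllR_of_thm23SelfDual_of_items
    (h23 : ErratumThm23SigmaLeSelfDual)
    (hMF : ErratumHidaMemberFramesNonsplitWt) (hloc : JSWSigmaLocalCharIdeal) (hF : PublishedInputsIMCReduction) :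
    IMCDivAtErratumDataAllR := fun W _ _ p _ ↦
  Summit.BirchSwinnertonDyer.Rank1Residual.X11b.P2.imcDivIntCoreFrameAtErratumDataB_of_roadFF_fitting
    (Summit.BirchSwinnertonDyer.Rank1Residual.X11b.P2.RoadFF.sigmaDataAtErratumDataB_of_sigmaLocal_of_prop323_of_facts
      W p hloc Literature.NumberTheory.EllipticCurves.SkinnerUrban2014.prop323_XAc_equiv_XBigDecomp_holds
      hF.2.1 hF.2.2.2.1 hF.2.2.2.2.2.2.2.2.2.2.2.2.1 hF.2.2.2.2.2.2.2.2.2.2.2.2.2.1)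
    (Summit.BirchSwinnertonDyer.Rank1Residual.X11b.P2.RoadFF.fittingCongruenceFrameAtErratumDataB_of_thm23SelfDual_OPEN_of_framesNonsplitWt
      h23 hMF W p)

/-- **The rung-K2a leaf from F4♯‡ and the fourteen other binders of `Theses.ErratumRoadFive.closes` (rev 71) VERBATIM** — `closes` with
`h23 : ErratumThm23SigmaLeSelfDual` (crux 23253, F4♯†) replaced by the print-faithful
`h23 : Castella2018.erratumThm23_charIdeal_sigma_le_of_isTorsion_selfDual_irrK_OPEN` (F4♯‡); body = `closes`' body, `h3` from
`imcDivAtErratumDataAllR_of_thm23SelfDualIrrK_OPEN_of_items`. Certificate that the RAMFREE re-key of crux 23253 is a one-token edit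
of the deciding theorem. CONDITIONAL on every binder; BSD is proved for no pair.
[cite: Castella2018Erratum, Thm. 1.1, Thm. 2.3 (i), (iii) (pp. 1–4)] [cite: Castella2018Exceptional, Thms. 2.10–2.11]
[cite: Wuthrich2014, Prop. 21] -/
theorem multiplicativeRankOne_of_thm23SelfDualIrrK_OPEN_of_items
    (h23 : erratumThm23_charIdeal_sigma_le_of_isTorsion_selfDual_irrK_OPEN)
    (hMF : ErratumHidaMemberFramesNonsplitWt)
    (hloc : JSWSigmaLocalCharIdeal)
    (hrest : RamNoErratumDataAtFive) (hOff : OpenInputNotRam)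
    (hF : PublishedInputsIMCReduction) (hVN : BDPValueContinuityInput)
    (hRes : EulerHalfNotRamNoInertSetAtFive) (h₃ : X11aLowerHalf) (h₄ : NonSurjCorner)
    (h₅ : PublishedInputsFive) (hJL : ShimuraParametrizationDataNonempty) (hCO : PastenComponentOrdersInput)
    (hCTi : ShimuraCasselsTateLevelInputs) (hESi : ShimuraHeegnerEulerSystemInertPrintedR) :
    Summit.BirchSwinnertonDyer.Rank1Residual.X11b.MultiplicativeRankOne := by
  have h3 : IMCDivAtErratumDataAllR := imcDivAtErratumDataAllR_of_thm23SelfDualIrrK_OPEN_of_items h23 hMF hloc hF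
  obtain ⟨hGZ, hKo, hB, hSk, hWu', hGZK, hmod, hnf, hHL, hFHs, hMaz, hBDMTV, hFH, hPT, hEP⟩ := h₅
  have hESg : Literature.NumberTheory.EllipticCurves.shimuraCurve_heegnerSystem_primitivesGuarded :=
    Summit.BirchSwinnertonDyer.BirchSwinnertonDyer.Theorems.primitivesGuarded_of_GZK_of_entire_of_primitivesFromFive
      hGZK hmod hESi
  have hKOi : ShimuraKolyvaginOrderBoundInertFromFive := by
    refine Summit.BirchSwinnertonDyer.BirchSwinnertonDyer.Theorems.shimuraKolyvaginOrderBoundInert_of_shimuraLabelsGuarded_of_casselsTate_of_poitouTate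
      hPT ?_ hESg
    intro K _ _ W _ p M₀ hp hp2 hM₀ _ c hc hcc e hμ hadd₁ hadd₂ hgal halt hnd
    obtain ⟨inv, hPT', hH3, hperf, hB', hPτ⟩ := hCTi K W p M₀ hp hp2 hM₀ c hc hcc e hμ hadd₁ hadd₂ hgal halt hnd
    exact ⟨inv, hPT', hH3, fun v ↦ (hperf v).1.injective, hB', hPτ⟩
  have hHKi : Literature.NumberTheory.EllipticCurves.shimuraCurve_heegnerPoint_grossZagier_kolyvagin_inert := by
    intro W _ _ p _ N _ K _ _ S Dt X W' _ P₀ hN hp5 hsurj hK hS hin hsp hpS hc hmin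
    obtain ⟨-, y, degy, -, -, h0y, hvy, hLy, -⟩ := hESg W p N K S Dt X W' P₀ hN hp5 hsurj hK hS hin hsp hpS hc hmin
    exact ⟨y, degy, h0y, hvy, hLy,
      hKOi W p N K S Dt X W' P₀ hN hp5 hsurj hK hS hin hsp hpS hc hmin y degy h0y hvy hLy⟩
  have h₁ : ∀ (W : WeierstrassCurve ℚ) [W.IsElliptic] [W.IsGloballyMinimal] (p : ℕ) [Fact p.Prime],
      Summit.BirchSwinnertonDyer.Rank1Residual.X11b.P2OpenInputOnTreeAt W p :=
    Summit.BirchSwinnertonDyer.BirchSwinnertonDyer.Theorems.KernelFromPrintB.openInputIMCBody_of_print_of_coreB_of_rest3_of_notRam_of_facts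
      hVN h3 hF hWu' hrest hOff
  exact Summit.BirchSwinnertonDyer.BirchSwinnertonDyer.Theorems.multiplicativeRankOne_of_endState_inert_notRamResidual
    hGZ hKo hB hSk hWu' hGZK hmod hnf hHL hFHs hMaz hBDMTV hFH hPT hEP hJL hCO hHKi h₁ hRes h₃ h₄

/-- **The parent 19061 `OpenInputIMC` BY NAME from F4♯‡ + seven route ITEMS** (23050, 20495, 19283, 19625 `BDPValueContinuityInput`, 19285
`WuthrichShaDividesAnalyticSha`, 19624 `RamNoErratumDataAtFive`, 19282 `OpenInputNotRam`): «[FW21 4.41] for ONE newform with the PRINTED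
hypotheses (F4♯‡) → published member data → … → `P2OpenInputOnTreeAt` at every X11b pair, `p ≥ 5`», modulo the residual cruxes REST‴ ∕ ¬ram —
composition with bdp's `KernelFromPrintB.openInputIMCBody_of_print_of_coreB_of_rest3_of_notRam_of_facts`. CONDITIONAL; nothing booked.
[cite: Castella2018Erratum, Thm. 1.1, Thm. 2.3 (i), (iii) and proof (pp. 1–4)] [cite: Castella2018Exceptional, Thms. 2.10–2.11]
[cite: Wuthrich2014, Prop. 21] -/
theorem openInputIMC_of_thm23SelfDualIrrK_OPEN_of_items
    (h23 : erratumThm23_charIdeal_sigma_le_of_isTorsion_selfDual_irrK_OPEN)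
    (hMF : ErratumHidaMemberFramesNonsplitWt) (hloc : JSWSigmaLocalCharIdeal) (hF : PublishedInputsIMCReduction)
    (hVN : BDPValueContinuityInput) (hWu : WuthrichShaDividesAnalyticSha) (hrest : RamNoErratumDataAtFive)
    (hOff : OpenInputNotRam) : OpenInputIMC := by
  intro W _ _ p _
  exact Summit.BirchSwinnertonDyer.BirchSwinnertonDyer.Theorems.KernelFromPrintB.openInputIMCBody_of_print_of_coreB_of_rest3_of_notRam_of_facts
    hVN (imcDivAtErratumDataAllR_of_thm23SelfDualIrrK_OPEN_of_items h23 hMF hloc hF) hF hWu hrest hOff W p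

end Summit.BirchSwinnertonDyer.BirchSwinnertonDyer.Theorems.RekeyIrrK

end
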